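import Summits.HodgeConjecture.HodgeConjecture.Theorems.Ring2WeilCoverageCMFieldRationalClassesDyadic
import Summits.HodgeConjecture.HodgeConjecture.Theorems.Ring2WeilCoverageCMFieldCyclicPrimeRuleSqrtFive
import Mathlib.NumberTheory.Padics.PadicVal.Basic
import HarnessLib

/-!
# Ring 2 — Weil-family coverage, CM-field rows: the label `T(c)` of a RATIONAL class is the union of the fibres of
  `Spec 𝓞_F → Spec ℤ` over the NON-NORM primes of ODD exponent in `c` — the union statement as one kernel theorem
  (WEIL-FAMILY-COVERAGE «## b03», cell (xxi⁷), part 41)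

research route conditional on HC_CM; not a corollary; Q11.4-sentence-2 already refuted in dim ≥ 3.

The rows `W_{2k}.E.δ` of a census table over Deligne's carrier `R` (`F = ℚ[S]/(R) = ℚ(θ)`, `E = F(√θ)`,
`δ ∈ F^×/Nm_{E/F}(E^×) = cmNormResidueGroup R`) are labelled by `T(q) = badPlaces q θ`, the finite even set of places
of `F` at which `(q, θ)_𝔭 = -1` (parts 1–11: `[q] = [q'] ⟺ T(q) = T(q')`) [cite: Deligne1982HodgeCycles, §4 (1),
Prop. 4.1, Cor. 4.2].  Parts 33–40 decided, for the fifteen BIQUADRATIC quartic CM fields of the census, every finite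
place of `F` against a rational class `c ∈ ℚ_{>0}` separately (saturation over odd split primes, exclusion of the
dyadic, the odd ramified and the odd inert radicand places).  This file assembles those verdicts into the UNION
STATEMENT, uniformly in the carrier:

* §114 (any carrier) PRIME SUPPORT: `T(1) = ∅`, `T(xy) = T(x) ∆ T(y)`, `T(x⁻¹) = T(x)`; if a place `x` lies in no
  `T(ℓ)` for the primes `ℓ ≠ ℓ₀`, then for `n ≥ 1` and `c ∈ ℚ_{>0}`:
  **`x ∈ T(c) ⟺ ord_{ℓ₀}(c)` odd `∧ x ∈ T(ℓ₀)`** (induction on the prime factorisation, `Nat.recOnMul`, `padicValRat`);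
  every finite place contains exactly one rational prime; no infinite place lies in `T(c)` for `c > 0`, every
  infinite place lies in `T(c)` for `c < 0` (`θ` totally negative) [cite: Omeara1963, §63B].
* §115 (quadratic carriers `R = S² + pS + q` with INTEGER radicand, `θ = c₁²·b₀`, `b₀ ∈ ℤ` — the biquadratic fields)
  **THE FIBRE STRUCTURE OF `T(ℓ)`**: if the dyadic places and the odd places dividing `b₀` lie in no `T(ℓ')` (`ℓ'`
  prime; parts 34–40 per carrier), then for every prime `ℓ` and every finite place `v`:
  **`v ∈ T(ℓ) ⟺ ℓ ∈ v ∧ T(ℓ) ≠ ∅`** — `T(ℓ)` is EMPTY or the FULL FIBRE over `ℓ` (a bad place is odd and prime to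
  `b₀`, hence divides `ℓ` by O'Meara 63:12; conversely saturation, part 33 (A)) [cite: Omeara1963, §63B Cor. 63:11a
  and Example 63:12].
* §116 **THE UNION STATEMENT**: for `c ∈ ℚ_{>0}` and a finite place `v` over the rational prime `ℓ`:
  **`v ∈ T(c) ⟺ ord_ℓ(c)` odd `∧ [ℓ] ≠ [1]`**, i.e. `T(c) = ⋃ {fibre over ℓ : ℓ prime, [ℓ] ≠ [1], ord_ℓ(c) odd}`;
  hence **`[c] = [c'] ⟺ ord_ℓ(c) ≡ ord_ℓ(c') (mod 2)` for every NON-NORM prime `ℓ`** (`c, c' > 0`), and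
  **`[c] = [(-1)^k]` (split, `k` even) `⟺ ord_ℓ(c)` even for every non-norm prime** — the positive rational classes
  of the table are in bijection with the finite sets of non-norm primes (`c ↦ {ℓ : [ℓ] ≠ [1], ord_ℓ c odd}`), the
  rational rows are EXACTLY the finite unions of non-norm fibres, and the prime rules of parts 16–20 (`[ℓ] ≠ [1] ⟺ ℓ
  mod N ∈ S_E`) finish the description (instances in the sequel) [cite: Deligne1982HodgeCycles, §4 (1) and Cor. 4.2].

No new definition, no named fact, no sorry; nothing about the Hodge conjecture is asserted.
-/

noncomputable section

set_option linter.dupNamespace false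

open Polynomial NumberField IsDedekindDomain

namespace Summit.HodgeConjecture.HodgeConjecture.Ring2.WeilCoverageCM

open Literature.AlgebraicGeometry.Deligne1982
open Literature.AlgebraicGeometry.HodgeTheory (splitDiscriminantClassCM)
open Literature.NumberTheory.QuadraticForms

variable {R : Polynomial ℤ} [Fact (Irreducible (cmPolyQ R))] [Fact (Irreducible (realPolyQ R))]

/-! ### §114 Prime support of a rational class — every carrier -/

section AnyField

variable {K : Type*} [Field K] [NumberField K]

/-- **Every finite place contains a rational prime** (`N v ∈ v` factors into primes, and `v` is prime). [folklore] -/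
theorem exists_prime_natCast_mem (v : HeightOneSpectrum (𝓞 K)) :
    ∃ ℓ : ℕ, ℓ.Prime ∧ (ℓ : 𝓞 K) ∈ v.asIdeal := by
  have key : ∀ n : ℕ, n ≠ 0 → (n : 𝓞 K) ∈ v.asIdeal → ∃ ℓ : ℕ, ℓ.Prime ∧ (ℓ : 𝓞 K) ∈ v.asIdeal := by
    intro n
    induction n using Nat.recOnMul with
    | zero => exact fun h ↦ absurd rfl h
    | one =>
      intro _ h1
      rw [Nat.cast_one] at h1
      exact absurd ((Ideal.eq_top_iff_one _).2 h1) v.isPrime.ne_top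
    | prime p hp => exact fun _ h ↦ ⟨p, hp, h⟩
    | mul a b iha ihb =>
      intro hab h
      rw [Nat.cast_mul] at h
      rcases v.isPrime.mem_or_mem h with ha | hb
      · exact iha (fun h0 ↦ hab (by rw [h0, zero_mul])) ha
      · exact ihb (fun h0 ↦ hab (by rw [h0, mul_zero])) hb
  refine key (Ideal.absNorm v.asIdeal) ?_ (Ideal.absNorm_mem v.asIdeal)
  rw [Ne, Ideal.absNorm_eq_zero_iff]
  exact v.ne_bot

omit [NumberField K] in
/-- **A finite place contains at most one rational prime** (`v ∩ ℤ = ℓℤ`). [folklore] -/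
theorem prime_natCast_mem_unique {ℓ ℓ' : ℕ} (hℓ : ℓ.Prime) (hℓ' : ℓ'.Prime) (v : HeightOneSpectrum (𝓞 K))
    (h : (ℓ : 𝓞 K) ∈ v.asIdeal) (h' : (ℓ' : 𝓞 K) ∈ v.asIdeal) : ℓ = ℓ' := by
  have hd : (ℓ : ℤ) ∣ (ℓ' : ℤ) := (intCast_mem_iff_natCast_dvd hℓ v h (ℓ' : ℤ)).1 (by exact_mod_cast h')
  exact (Nat.prime_dvd_prime_iff_eq hℓ hℓ').1 (by exact_mod_cast hd)

end AnyField

/-- **PRIME SUPPORT, integers**: if the place `x` lies in no `T(ℓ)` for the primes `ℓ ≠ ℓ₀`, then for `n ≥ 1`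
**`x ∈ T(n) ⟺ ord_{ℓ₀}(n)` odd `∧ x ∈ T(ℓ₀)`** (`T(1) = ∅`, `T(ab) = T(a) ∆ T(b)`, induction on the factorisation).
[cite: Deligne1982HodgeCycles, §4 (1)] [cite: Omeara1963, §63B (multiplicativity of the symbol)] -/
theorem mem_badPlaces_natCast_iff_of_prime_support
    (x : HeightOneSpectrum (𝓞 (realField R)) ⊕ InfinitePlace (realField R)) {ℓ₀ : ℕ} (hℓ₀ : ℓ₀.Prime)
    (hx : ∀ ℓ : ℕ, ℓ.Prime → ℓ ≠ ℓ₀ → x ∉ badPlaces (ℓ : realField R) (AdjoinRoot.root (realPolyQ R)))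
    {n : ℕ} (hn : n ≠ 0) :
    x ∈ badPlaces (n : realField R) (AdjoinRoot.root (realPolyQ R)) ↔
      Odd (padicValNat ℓ₀ n) ∧ x ∈ badPlaces (ℓ₀ : realField R) (AdjoinRoot.root (realPolyQ R)) := by
  haveI : Fact ℓ₀.Prime := ⟨hℓ₀⟩
  induction n using Nat.recOnMul with
  | zero => exact absurd rfl hn
  | one =>
    rw [Nat.cast_one, badPlaces_one, padicValNat_one_right]
    exact ⟨fun h ↦ absurd h (Set.notMem_empty _), fun h ↦ absurd h.1 (Nat.not_odd_iff_even.2 ⟨0, rfl⟩)⟩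
  | prime p hp =>
    by_cases hp0 : p = ℓ₀
    · subst hp0
      rw [padicValNat_self]
      exact ⟨fun h ↦ ⟨odd_one, h⟩, fun h ↦ h.2⟩
    · haveI : Fact p.Prime := ⟨hp⟩
      rw [padicValNat_primes (Ne.symm hp0)]
      exact ⟨fun h ↦ absurd h (hx p hp hp0), fun h ↦ absurd h.1 (Nat.not_odd_iff_even.2 ⟨0, rfl⟩)⟩
  | mul a b iha ihb =>
    have ha : a ≠ 0 := fun h ↦ hn (by rw [h, zero_mul])
    have hb : b ≠ 0 := fun h ↦ hn (by rw [h, mul_zero])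
    have iha' : x ∈ badPlaces ((a : ℕ) : realField R) (AdjoinRoot.root (realPolyQ R)) ↔
        Odd (padicValNat ℓ₀ a) ∧ x ∈ badPlaces (ℓ₀ : realField R) (AdjoinRoot.root (realPolyQ R)) := iha ha
    have ihb' : x ∈ badPlaces ((b : ℕ) : realField R) (AdjoinRoot.root (realPolyQ R)) ↔
        Odd (padicValNat ℓ₀ b) ∧ x ∈ badPlaces (ℓ₀ : realField R) (AdjoinRoot.root (realPolyQ R)) := ihb hb
    rw [Nat.cast_mul, badPlaces_mul (by exact_mod_cast ha) (by exact_mod_cast hb) root_realPolyQ_ne_zero,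
      Set.mem_symmDiff, iha', ihb', padicValNat.mul ha hb, Nat.odd_add', ← Nat.not_odd_iff_even]
    clear iha ihb iha' ihb' hx
    generalize (Odd (padicValNat ℓ₀ a)) = A
    generalize (Odd (padicValNat ℓ₀ b)) = B
    generalize (x ∈ badPlaces (ℓ₀ : realField R) (AdjoinRoot.root (realPolyQ R))) = P
    tauto

/-- **PRIME SUPPORT, positive rationals**: if the place `x` lies in no `T(ℓ)` for the primes `ℓ ≠ ℓ₀`, then for
`c ∈ ℚ_{>0}` **`x ∈ T(c) ⟺ ord_{ℓ₀}(c)` odd `∧ x ∈ T(ℓ₀)`** (`c = num/den`, `T(x⁻¹) = T(x)`, `padicValRat`).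
[cite: Deligne1982HodgeCycles, §4 (1)] [cite: Omeara1963, §63B (multiplicativity of the symbol)] -/
theorem mem_badPlaces_ratCast_iff_of_prime_support
    (x : HeightOneSpectrum (𝓞 (realField R)) ⊕ InfinitePlace (realField R)) {ℓ₀ : ℕ} (hℓ₀ : ℓ₀.Prime)
    (hx : ∀ ℓ : ℕ, ℓ.Prime → ℓ ≠ ℓ₀ → x ∉ badPlaces (ℓ : realField R) (AdjoinRoot.root (realPolyQ R)))
    {c : ℚ} (hc : 0 < c) :
    x ∈ badPlaces (c : realField R) (AdjoinRoot.root (realPolyQ R)) ↔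
      Odd (padicValRat ℓ₀ c) ∧ x ∈ badPlaces (ℓ₀ : realField R) (AdjoinRoot.root (realPolyQ R)) := by
  haveI : Fact ℓ₀.Prime := ⟨hℓ₀⟩
  have hnum : 0 < c.num := Rat.num_pos.2 hc
  obtain ⟨m, hm⟩ : ∃ m : ℕ, (m : ℤ) = c.num := ⟨c.num.toNat, Int.toNat_of_nonneg hnum.le⟩
  have hm0 : m ≠ 0 := by rintro rfl; rw [Nat.cast_zero] at hm; exact hnum.ne' hm.symm
  have hden : c.den ≠ 0 := c.den_nz
  have hdenF : ((c.den : ℕ) : realField R) ≠ 0 := by exact_mod_cast hden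
  have hmF : ((m : ℕ) : realField R) ≠ 0 := by exact_mod_cast hm0
  have ec : (c : realField R) = (m : realField R) * ((c.den : realField R))⁻¹ := by
    rw [← div_eq_mul_inv, Rat.cast_def, ← hm, Int.cast_natCast]
  have hinv : badPlaces (((c.den : ℕ) : realField R))⁻¹ (AdjoinRoot.root (realPolyQ R)) =
      badPlaces ((c.den : ℕ) : realField R) (AdjoinRoot.root (realPolyQ R)) := by
    have h := badPlaces_inv (R := R) (Units.mk0 ((c.den : ℕ) : realField R) hdenF)
    rwa [Units.val_inv_eq_inv_val, Units.val_mk0] at h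
  -- `ord_{ℓ₀}(c) = ord_{ℓ₀}(m) - ord_{ℓ₀}(den)`
  have hcq : ((m : ℚ) / (c.den : ℚ)) = c := by
    rw [← Int.cast_natCast m, hm]; exact Rat.num_div_den c
  have hval : padicValRat ℓ₀ c = (padicValNat ℓ₀ m : ℤ) - (padicValNat ℓ₀ c.den : ℤ) := by
    conv_lhs => rw [← hcq]
    rw [padicValRat.div (by exact_mod_cast hm0) (by exact_mod_cast hden), padicValRat.of_nat, padicValRat.of_nat]
  rw [ec, badPlaces_mul hmF (inv_ne_zero hdenF) root_realPolyQ_ne_zero, hinv, Set.mem_symmDiff,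
    mem_badPlaces_natCast_iff_of_prime_support x hℓ₀ hx hm0, mem_badPlaces_natCast_iff_of_prime_support x hℓ₀ hx hden,
    hval, Int.odd_sub', Int.odd_coe_nat, Int.even_coe_nat, ← Nat.not_odd_iff_even]
  clear hx hinv ec hval hcq
  generalize (Odd (padicValNat ℓ₀ m)) = A
  generalize (Odd (padicValNat ℓ₀ c.den)) = B
  generalize (x ∈ badPlaces (ℓ₀ : realField R) (AdjoinRoot.root (realPolyQ R))) = P
  tauto

/-- **No infinite place lies in `T(c)`, `c ∈ ℚ_{>0}`** (`θ` totally negative, `c > 0` at every real place; via the primes).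
[cite: Omeara1963, §63B (the symbol over `ℝ`)] [cite: Deligne1982HodgeCycles, §4 (1)] -/
theorem inr_notMem_badPlaces_ratCast_of_pos
    (hroots : ∀ s : ℂ, Polynomial.eval₂ (Int.castRingHom ℂ) s R = 0 → s.im = 0 ∧ s.re < 0)
    (w : InfinitePlace (realField R)) {c : ℚ} (hc : 0 < c) :
    Sum.inr w ∉ badPlaces (c : realField R) (AdjoinRoot.root (realPolyQ R)) :=
  notMem_badPlaces_ratCast_of_forall_prime _ (fun _ hℓ ↦ inr_notMem_badPlaces_natCast hroots w hℓ) hc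

omit [Fact (Irreducible (cmPolyQ R))] in
/-- **Every infinite place lies in `T(c)` for `c ∈ ℚ_{<0}`** (`θ < 0` and `c < 0` at every real place: `(c, θ)_w = -1`)
— negative rationals never index a polarized row. [cite: Omeara1963, §63B (the symbol over `ℝ`)]
[cite: Deligne1982HodgeCycles, §4 (1)] -/
theorem inr_mem_badPlaces_ratCast_of_neg
    (hroots : ∀ s : ℂ, Polynomial.eval₂ (Int.castRingHom ℂ) s R = 0 → s.im = 0 ∧ s.re < 0)
    (w : InfinitePlace (realField R)) {c : ℚ} (hc : c < 0) :
    Sum.inr w ∈ badPlaces (c : realField R) (AdjoinRoot.root (realPolyQ R)) := by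
  rw [mem_badPlaces_iff, ← placeSymbol_ne_one_iff, placeSymbol_inr, Ne,
    hilbertSymbol_completion_root_eq_one_iff hroots w, map_ratCast, not_lt]
  exact_mod_cast hc.le

/-! ### §115 The fibre structure of `T(ℓ)` for an integer radicand (the biquadratic carriers) -/

/-- **`T(ℓ)` IS EMPTY OR THE FULL FIBRE OVER `ℓ`.** Let `R = S² + pS + q` (roots real negative), `θ = c₁²·b₀` with
`b₀ ∈ ℤ`, and suppose the dyadic places of `F` and the odd places dividing `b₀` lie in no `T(ℓ')`, `ℓ'` prime (parts
34–40). Then for every prime `ℓ` and every finite place `v`: **`v ∈ T(ℓ) ⟺ ℓ ∈ v ∧ T(ℓ) ≠ ∅`** (⟹: `v` is odd and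
prime to `b₀`, so `(ℓ, θ)_v = -1` forces `ord_v ℓ` odd, O'Meara 63:12; ⟸: a bad place is a finite `w ∋ ℓ` with `ℓ` odd and
prime to `b₀`, and `T(ℓ)` is constant on the fibre over such an `ℓ`, part 33 (A)). [cite: Omeara1963, §63B Cor. 63:11a
and Example 63:12] [cite: Deligne1982HodgeCycles, §4 (1) and Cor. 4.2] -/
theorem inl_mem_badPlaces_natCast_iff_mem_and_nonempty {p q : ℤ} (hR : R = X ^ 2 + C p * X + C q)
    (hroots : ∀ s : ℂ, Polynomial.eval₂ (Int.castRingHom ℂ) s R = 0 → s.im = 0 ∧ s.re < 0)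
    {c₁ : realField R} {b₀ : ℤ}
    (hfac : AdjoinRoot.root (realPolyQ R) = c₁ ^ 2 * ((b₀ : 𝓞 (realField R)) : realField R))
    (hexc : ∀ v : HeightOneSpectrum (𝓞 (realField R)),
      (2 : 𝓞 (realField R)) ∈ v.asIdeal ∨ (b₀ : 𝓞 (realField R)) ∈ v.asIdeal →
        ∀ ℓ : ℕ, ℓ.Prime → Sum.inl v ∉ badPlaces (ℓ : realField R) (AdjoinRoot.root (realPolyQ R)))
    {ℓ : ℕ} (hℓ : ℓ.Prime) (v : HeightOneSpectrum (𝓞 (realField R))) :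
    Sum.inl v ∈ badPlaces (ℓ : realField R) (AdjoinRoot.root (realPolyQ R)) ↔
      (ℓ : 𝓞 (realField R)) ∈ v.asIdeal ∧ (badPlaces (ℓ : realField R) (AdjoinRoot.root (realPolyQ R))).Nonempty := by
  constructor
  · intro hv
    have h2 : (2 : 𝓞 (realField R)) ∉ v.asIdeal := fun h ↦ hexc v (Or.inl h) ℓ hℓ hv
    have hb : (b₀ : 𝓞 (realField R)) ∉ v.asIdeal := fun h ↦ hexc v (Or.inr h) ℓ hℓ hv
    exact ⟨natCast_mem_of_inl_mem_badPlaces hfac v h2 hb hℓ hv, ⟨_, hv⟩⟩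
  · rintro ⟨hℓv, x, hx⟩
    obtain ⟨w, rfl⟩ : ∃ w : HeightOneSpectrum (𝓞 (realField R)), x = Sum.inl w := by
      rcases x with w | w
      · exact ⟨w, rfl⟩
      · exact absurd hx (inr_notMem_badPlaces_natCast hroots w hℓ)
    have h2w : (2 : 𝓞 (realField R)) ∉ w.asIdeal := fun h ↦ hexc w (Or.inl h) ℓ hℓ hx
    have hbw : (b₀ : 𝓞 (realField R)) ∉ w.asIdeal := fun h ↦ hexc w (Or.inr h) ℓ hℓ hx
    have hℓw := natCast_mem_of_inl_mem_badPlaces hfac w h2w hbw hℓ hx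
    have hℓ2 : ℓ ≠ 2 := by
      rintro rfl
      exact h2w (by exact_mod_cast hℓw)
    have hℓb : ¬ (ℓ : ℤ) ∣ b₀ := fun h ↦ hbw ((intCast_mem_iff_natCast_dvd hℓ w hℓw b₀).2 h)
    have key := (inl_mem_badPlaces_ratCast_iff_of_intCast_radicand hR hfac hℓ hℓ2 hℓb w v hℓw hℓv
      (c := (ℓ : ℚ)) (by exact_mod_cast hℓ.ne_zero)).1
    rw [Rat.cast_natCast] at key
    exact key hx

/-- Under the same hypotheses **a finite place lies in at most ONE `T(ℓ)`**: `v ∈ T(ℓ) ⟹ ℓ ∈ v`, and `v` contains one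
rational prime. [cite: Omeara1963, §63B Example 63:12] -/
theorem inl_notMem_badPlaces_natCast_of_ne {p q : ℤ} (hR : R = X ^ 2 + C p * X + C q)
    (hroots : ∀ s : ℂ, Polynomial.eval₂ (Int.castRingHom ℂ) s R = 0 → s.im = 0 ∧ s.re < 0)
    {c₁ : realField R} {b₀ : ℤ}
    (hfac : AdjoinRoot.root (realPolyQ R) = c₁ ^ 2 * ((b₀ : 𝓞 (realField R)) : realField R))
    (hexc : ∀ v : HeightOneSpectrum (𝓞 (realField R)),
      (2 : 𝓞 (realField R)) ∈ v.asIdeal ∨ (b₀ : 𝓞 (realField R)) ∈ v.asIdeal →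
        ∀ ℓ : ℕ, ℓ.Prime → Sum.inl v ∉ badPlaces (ℓ : realField R) (AdjoinRoot.root (realPolyQ R)))
    (v : HeightOneSpectrum (𝓞 (realField R))) {ℓ₀ : ℕ} (hℓ₀ : ℓ₀.Prime) (hℓ₀v : (ℓ₀ : 𝓞 (realField R)) ∈ v.asIdeal)
    {ℓ : ℕ} (hℓ : ℓ.Prime) (hne : ℓ ≠ ℓ₀) :
    Sum.inl v ∉ badPlaces (ℓ : realField R) (AdjoinRoot.root (realPolyQ R)) := fun h ↦
  hne (prime_natCast_mem_unique hℓ hℓ₀ v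
    ((inl_mem_badPlaces_natCast_iff_mem_and_nonempty hR hroots hfac hexc hℓ v).1 h).1 hℓ₀v)

/-! ### §116 The union statement and the classes of the positive rationals -/

/-- **THE UNION STATEMENT.** `R = S² + pS + q` with integer radicand (`θ = c₁²·b₀`), the dyadic and odd radicand places
in no `T(ℓ')` (parts 34–40). Then for `c ∈ ℚ_{>0}` and a finite place `v` over the rational prime `ℓ`:
**`v ∈ T(c) ⟺ ord_ℓ(c)` is odd `∧ T(ℓ) ≠ ∅`** (`[ℓ] ≠ [1]`: `ℓ` a non-norm) — `T(c)` is the UNION OF THE FULL FIBRES of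
`Spec 𝓞_F → Spec ℤ` over the non-norm primes of odd exponent in `c`. [cite: Deligne1982HodgeCycles, §4 (1) and Cor. 4.2]
[cite: Omeara1963, §63B Cor. 63:11a, Example 63:12 and §71D Thm. 71:18] -/
theorem inl_mem_badPlaces_ratCast_iff_odd_padicValRat {p q : ℤ} (hR : R = X ^ 2 + C p * X + C q)
    (hroots : ∀ s : ℂ, Polynomial.eval₂ (Int.castRingHom ℂ) s R = 0 → s.im = 0 ∧ s.re < 0)
    {c₁ : realField R} {b₀ : ℤ}
    (hfac : AdjoinRoot.root (realPolyQ R) = c₁ ^ 2 * ((b₀ : 𝓞 (realField R)) : realField R))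
    (hexc : ∀ v : HeightOneSpectrum (𝓞 (realField R)),
      (2 : 𝓞 (realField R)) ∈ v.asIdeal ∨ (b₀ : 𝓞 (realField R)) ∈ v.asIdeal →
        ∀ ℓ : ℕ, ℓ.Prime → Sum.inl v ∉ badPlaces (ℓ : realField R) (AdjoinRoot.root (realPolyQ R)))
    {c : ℚ} (hc : 0 < c) (v : HeightOneSpectrum (𝓞 (realField R))) {ℓ : ℕ} (hℓ : ℓ.Prime)
    (hℓv : (ℓ : 𝓞 (realField R)) ∈ v.asIdeal) :
    Sum.inl v ∈ badPlaces (c : realField R) (AdjoinRoot.root (realPolyQ R)) ↔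
      Odd (padicValRat ℓ c) ∧ (badPlaces (ℓ : realField R) (AdjoinRoot.root (realPolyQ R))).Nonempty := by
  rw [mem_badPlaces_ratCast_iff_of_prime_support _ hℓ
      (fun ℓ' hℓ' hne ↦ inl_notMem_badPlaces_natCast_of_ne hR hroots hfac hexc v hℓ hℓv hℓ' hne) hc,
    inl_mem_badPlaces_natCast_iff_mem_and_nonempty hR hroots hfac hexc hℓ v]
  exact ⟨fun h ↦ ⟨h.1, h.2.2⟩, fun h ↦ ⟨h.1, hℓv, h.2⟩⟩

/-- **THE UNION STATEMENT, prime-free form**: for `c ∈ ℚ_{>0}` and a finite place `v`: `v ∈ T(c)` iff SOME prime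
`ℓ ∈ v` (necessarily the prime under `v`) has `ord_ℓ(c)` odd and `T(ℓ) ≠ ∅`. [cite: Deligne1982HodgeCycles, §4 (1)
and Cor. 4.2] [cite: Omeara1963, §63B Example 63:12] -/
theorem inl_mem_badPlaces_ratCast_iff_exists_prime {p q : ℤ} (hR : R = X ^ 2 + C p * X + C q)
    (hroots : ∀ s : ℂ, Polynomial.eval₂ (Int.castRingHom ℂ) s R = 0 → s.im = 0 ∧ s.re < 0)
    {c₁ : realField R} {b₀ : ℤ}
    (hfac : AdjoinRoot.root (realPolyQ R) = c₁ ^ 2 * ((b₀ : 𝓞 (realField R)) : realField R))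
    (hexc : ∀ v : HeightOneSpectrum (𝓞 (realField R)),
      (2 : 𝓞 (realField R)) ∈ v.asIdeal ∨ (b₀ : 𝓞 (realField R)) ∈ v.asIdeal →
        ∀ ℓ : ℕ, ℓ.Prime → Sum.inl v ∉ badPlaces (ℓ : realField R) (AdjoinRoot.root (realPolyQ R)))
    {c : ℚ} (hc : 0 < c) (v : HeightOneSpectrum (𝓞 (realField R))) :
    Sum.inl v ∈ badPlaces (c : realField R) (AdjoinRoot.root (realPolyQ R)) ↔
      ∃ ℓ : ℕ, ℓ.Prime ∧ (ℓ : 𝓞 (realField R)) ∈ v.asIdeal ∧ Odd (padicValRat ℓ c) ∧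
        (badPlaces (ℓ : realField R) (AdjoinRoot.root (realPolyQ R))).Nonempty := by
  obtain ⟨ℓ₀, hℓ₀, hℓ₀v⟩ := exists_prime_natCast_mem v
  rw [inl_mem_badPlaces_ratCast_iff_odd_padicValRat hR hroots hfac hexc hc v hℓ₀ hℓ₀v]
  constructor
  · rintro ⟨h1, h2⟩
    exact ⟨ℓ₀, hℓ₀, hℓ₀v, h1, h2⟩
  · rintro ⟨ℓ, hℓ, hℓv, h1, h2⟩
    obtain rfl := prime_natCast_mem_unique hℓ hℓ₀ v hℓv hℓ₀v
    exact ⟨h1, h2⟩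

/-- **THE CLASSES OF THE POSITIVE RATIONALS: `[c] = [c'] ⟺ ord_ℓ(c) ≡ ord_ℓ(c') (mod 2)` at every NON-NORM prime `ℓ`**
(`T(ℓ) ≠ ∅`), for `c, c' ∈ ℚ_{>0}` — the positive rational members of the table are classified by their finite sets
of non-norm primes of odd exponent. [cite: Deligne1982HodgeCycles, §4 (1), Prop. 4.1 and Cor. 4.2]
[cite: Omeara1963, §65D Thm. 65:23] -/
theorem mk_ratCast_eq_mk_ratCast_iff {p q : ℤ} (hR : R = X ^ 2 + C p * X + C q)
    (hroots : ∀ s : ℂ, Polynomial.eval₂ (Int.castRingHom ℂ) s R = 0 → s.im = 0 ∧ s.re < 0)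
    {c₁ : realField R} {b₀ : ℤ}
    (hfac : AdjoinRoot.root (realPolyQ R) = c₁ ^ 2 * ((b₀ : 𝓞 (realField R)) : realField R))
    (hexc : ∀ v : HeightOneSpectrum (𝓞 (realField R)),
      (2 : 𝓞 (realField R)) ∈ v.asIdeal ∨ (b₀ : 𝓞 (realField R)) ∈ v.asIdeal →
        ∀ ℓ : ℕ, ℓ.Prime → Sum.inl v ∉ badPlaces (ℓ : realField R) (AdjoinRoot.root (realPolyQ R)))
    {c c' : ℚ} (hc : 0 < c) (hc' : 0 < c') (γ γ' : (realField R)ˣ) (hγ : (γ : realField R) = (c : realField R))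
    (hγ' : (γ' : realField R) = (c' : realField R)) :
    (QuotientGroup.mk γ : cmNormResidueGroup R) = QuotientGroup.mk γ' ↔
      ∀ ℓ : ℕ, ℓ.Prime → (badPlaces (ℓ : realField R) (AdjoinRoot.root (realPolyQ R))).Nonempty →
        (Odd (padicValRat ℓ c) ↔ Odd (padicValRat ℓ c')) := by
  rw [mk_eq_mk_iff_badPlaces_eq, hγ, hγ', Set.ext_iff]
  constructor
  · intro h ℓ hℓ hne
    obtain ⟨v, hv⟩ := exists_place_natCast_mem (finrank_realField_quadratic hR) hℓ
    have e := h (Sum.inl v)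
    rw [inl_mem_badPlaces_ratCast_iff_odd_padicValRat hR hroots hfac hexc hc v hℓ hv,
      inl_mem_badPlaces_ratCast_iff_odd_padicValRat hR hroots hfac hexc hc' v hℓ hv] at e
    exact ⟨fun h1 ↦ (e.1 ⟨h1, hne⟩).1, fun h1 ↦ (e.2 ⟨h1, hne⟩).1⟩
  · rintro h (v | w)
    · obtain ⟨ℓ, hℓ, hℓv⟩ := exists_prime_natCast_mem v
      rw [inl_mem_badPlaces_ratCast_iff_odd_padicValRat hR hroots hfac hexc hc v hℓ hℓv,
        inl_mem_badPlaces_ratCast_iff_odd_padicValRat hR hroots hfac hexc hc' v hℓ hℓv]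
      exact ⟨fun h1 ↦ ⟨(h ℓ hℓ h1.2).1 h1.1, h1.2⟩, fun h1 ↦ ⟨(h ℓ hℓ h1.2).2 h1.1, h1.2⟩⟩
    · exact iff_of_false (inr_notMem_badPlaces_ratCast_of_pos hroots w hc)
        (inr_notMem_badPlaces_ratCast_of_pos hroots w hc')

/-- **THE SPLIT ROW: `[c] = [(-1)^k]` (`k` even) `⟺ ord_ℓ(c)` is EVEN at every non-norm prime `ℓ`**, for `c ∈ ℚ_{>0}` —
the rational analogue, for all positive rationals at once, of the integer theorems of parts IX-M / 27–31.
[cite: Deligne1982HodgeCycles, §4 Cor. 4.2] [cite: Omeara1963, §65D Thm. 65:23] -/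
theorem mk_ratCast_eq_splitDiscriminantClassCM_iff {p q : ℤ} (hR : R = X ^ 2 + C p * X + C q)
    (hroots : ∀ s : ℂ, Polynomial.eval₂ (Int.castRingHom ℂ) s R = 0 → s.im = 0 ∧ s.re < 0)
    {c₁ : realField R} {b₀ : ℤ}
    (hfac : AdjoinRoot.root (realPolyQ R) = c₁ ^ 2 * ((b₀ : 𝓞 (realField R)) : realField R))
    (hexc : ∀ v : HeightOneSpectrum (𝓞 (realField R)),
      (2 : 𝓞 (realField R)) ∈ v.asIdeal ∨ (b₀ : 𝓞 (realField R)) ∈ v.asIdeal →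
        ∀ ℓ : ℕ, ℓ.Prime → Sum.inl v ∉ badPlaces (ℓ : realField R) (AdjoinRoot.root (realPolyQ R)))
    {c : ℚ} (hc : 0 < c) (γ : (realField R)ˣ) (hγ : (γ : realField R) = (c : realField R)) {k : ℕ} (hk : Even k) :
    (QuotientGroup.mk γ : cmNormResidueGroup R) = splitDiscriminantClassCM R k ↔
      ∀ ℓ : ℕ, ℓ.Prime → (badPlaces (ℓ : realField R) (AdjoinRoot.root (realPolyQ R))).Nonempty →
        Even (padicValRat ℓ c) := by
  rw [mk_eq_splitDiscriminantClassCM_iff_badPlaces_eq_empty γ hk, hγ, Set.eq_empty_iff_forall_notMem]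
  constructor
  · intro h ℓ hℓ hne
    obtain ⟨v, hv⟩ := exists_place_natCast_mem (finrank_realField_quadratic hR) hℓ
    have e := h (Sum.inl v)
    rw [inl_mem_badPlaces_ratCast_iff_odd_padicValRat hR hroots hfac hexc hc v hℓ hv, not_and'] at e
    exact Int.not_odd_iff_even.1 (e hne)
  · rintro h (v | w)
    · obtain ⟨ℓ, hℓ, hℓv⟩ := exists_prime_natCast_mem v
      rw [inl_mem_badPlaces_ratCast_iff_odd_padicValRat hR hroots hfac hexc hc v hℓ hℓv, not_and']
      exact fun hne ↦ Int.not_odd_iff_even.2 (h ℓ hℓ hne)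
    · exact inr_notMem_badPlaces_ratCast_of_pos hroots w hc

/-- `T(t) ≠ ∅ ⟺ [t] ≠ [(-1)^k]` (`k` even): the non-emptiness hypothesis of §116 is «`t` is a NON-NORM», to be read off
the prime rules of parts 16–20. [cite: Deligne1982HodgeCycles, §4 Cor. 4.2] -/
theorem badPlaces_nonempty_iff_mk_ne_splitDiscriminantClassCM (u : (realField R)ˣ) {k : ℕ} (hk : Even k) :
    (badPlaces (u : realField R) (AdjoinRoot.root (realPolyQ R))).Nonempty ↔
      (QuotientGroup.mk u : cmNormResidueGroup R) ≠ splitDiscriminantClassCM R k := by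
  rw [Ne, mk_eq_splitDiscriminantClassCM_iff_badPlaces_eq_empty u hk, Set.nonempty_iff_ne_empty]

end Summit.HodgeConjecture.HodgeConjecture.Ring2.WeilCoverageCM

end
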